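import Summits.Ventures.PercRepro.C025ProfileGirthRows
import Summits.Ventures.PercRepro.C025ProfileThinRowStepsA

/-!
# THE ROW `(q, q+1)` OF THE PROFILE INEQUALITY AT GIRTH `≥ q + 1` ON MATROIDS OF RANK `≥ q + 3` (night-3 g18)

`C025ProfileGirthRows` proves the rows `(q, u)` at girth `≥ u` for `q ≤ u − 2` by one global count.  At `q = u − 1` the
count needs a refinement: with every `q`-subset independent (girth `≥ q + 1`) the rank-`q` sets are the `q`-subsets
(independent) AND the sets of `≥ q + 1` points of rank `q` (every subset of a rank-`q` flat with `≥ q + 1` points — the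
`(q+1)`-circuits and their fat supersets), and the `(q+1)`-circuits are missing from the level `q + 1`.  The refined count:
the `q`-subsets contribute at most `C(n, q+1)` (g6's price bound); a rank-`q` set `B` with `≥ q + 1` points has price
`ρ(E∖B)/(q+1) ≤ (q + m_B)/(q+1)` where `m_B = #(E ∖ cl B)`, and the `m_B` sets `B ∪ {y}`, `y ∉ cl B`, are rank-`(q+1)` sets
of `≥ q + 2` points, DISTINCT for distinct `(B, y)` (two such sets `B ∪ y = B' ∪ y'` with `B ≠ B'` make `B ∩ B'` a set of
`≥ q` points of rank `≤ q − 1` by submodularity — against the girth).  So the level is at least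
`#{independent (q+1)-subsets} + Σ_B m_B = C(n, q+1) − c + Σ_B m_B` (`c` = the number of `(q+1)`-circuits), and the row
follows from `(q + m_B)/(q+1) + [|B| = q+1] ≤ m_B`, which holds as soon as `m_B ≥ 3` — guaranteed by `ρ(E) ≥ q + 3`
(`E ∖ cl B` has rank `≥ ρ(E) − q ≥ 3`).  The case `ρ(E) = q + 2` (where some rank-`q` flat may have only two points outside)
needs a compensation between the `(q+1)`- and `(q+2)`-subsets of that flat and is NOT done here.
* `out`-style lemmas: `eRk_sdiff_le_add_card_out`, `three_le_card_out`, `price_succ_le_of_card_out`;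
* `insert_mem_levelSet_of_out`, `insert_ne_insert_of_ne` — the injection;
* `sum_price_le_choose_of_subset` — g6's bound for a sub-family of `q`-subsets;
* **`profileIneq_succ_of_girth_rank`** `(hq : 1 ≤ q) (hg : ∀ T ⊆ M.E, T.encard ≤ q → M.Indep T) (hrank : q + 3 ≤ ρ(E)) :
  ProfileIneq M q (q + 1)`; **`rls_succ_succ_of_girth_rank`** — C-025 at `(q + 2, q)` under the same hypotheses;
  **`rls_of_girth_rank`** — C-025 at `(p, q)` for every `p ≥ q + 2` at girth `≥ p − 1` and rank `≥ q + 3`.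
No `def`, no `instance`, no notation.  Axioms: standard.
-/

open scoped Matroid

namespace PercRepro

open Set Finset ThmH Staged

namespace GirthRows

variable {α : Type} [DecidableEq α] {M : Matroid α} [M.Finite]

open scoped Classical

/-- Every point of the ground set is in the closure of `B` or outside it: `E ∖ B ⊆ cl(B) ∪ (E ∖ cl B)`, so
`ρ(E ∖ B) ≤ ρ(B) + #(E ∖ cl B)`. -/
theorem eRk_sdiff_le_add_card_out (B : Finset α) :
    M.eRk ((gr M \ B : Finset α) : Set α) ≤
      M.eRk (B : Set α) + (((gr M).filter (fun x => x ∉ M.closure (B : Set α))).card : ℕ∞) := by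
  have hsub : ((gr M \ B : Finset α) : Set α) ⊆
      M.closure (B : Set α) ∪ (((gr M).filter (fun x => x ∉ M.closure (B : Set α)) : Finset α) : Set α) := by
    intro x hx
    rw [Finset.coe_sdiff, Set.mem_sdiff, Finset.mem_coe, Finset.mem_coe] at hx
    by_cases hc : x ∈ M.closure (B : Set α)
    · exact Or.inl hc
    · right
      rw [Finset.mem_coe, Finset.mem_filter]
      exact ⟨hx.1, hc⟩
  calc M.eRk ((gr M \ B : Finset α) : Set α)
      ≤ M.eRk (M.closure (B : Set α) ∪
          (((gr M).filter (fun x => x ∉ M.closure (B : Set α)) : Finset α) : Set α)) := M.eRk_mono hsub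
    _ ≤ M.eRk (M.closure (B : Set α)) +
          M.eRk ((((gr M).filter (fun x => x ∉ M.closure (B : Set α)) : Finset α) : Set α)) :=
        M.eRk_union_le_eRk_add_eRk _ _
    _ ≤ M.eRk (B : Set α) + (((gr M).filter (fun x => x ∉ M.closure (B : Set α))).card : ℕ∞) := by
        rw [M.eRk_closure_eq]
        gcongr
        rw [← Set.encard_coe_eq_coe_finsetCard]
        exact M.eRk_le_encard _

omit [DecidableEq α] in
/-- If `ρ(E) ≥ q + 3` then every rank-`q` set has at least three points of the ground set outside its closure. -/
theorem three_le_card_out {q : ℕ} (hrank : ((q + 3 : ℕ) : ℕ∞) ≤ M.eRank) {B : Finset α}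
    (hB : M.eRk (B : Set α) = (q : ℕ∞)) :
    3 ≤ ((gr M).filter (fun x => x ∉ M.closure (B : Set α))).card := by
  have hsub : M.E ⊆ M.closure (B : Set α) ∪
      (((gr M).filter (fun x => x ∉ M.closure (B : Set α)) : Finset α) : Set α) := by
    intro x hx
    by_cases hc : x ∈ M.closure (B : Set α)
    · exact Or.inl hc
    · right
      rw [Finset.mem_coe, Finset.mem_filter]
      exact ⟨ThinGirth.mem_gr_of_mem_ground hx, hc⟩
  have h1 : M.eRank ≤ (q : ℕ∞) + (((gr M).filter (fun x => x ∉ M.closure (B : Set α))).card : ℕ∞) := by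
    calc M.eRank = M.eRk M.E := Matroid.eRank_def M
      _ ≤ M.eRk (M.closure (B : Set α) ∪
            (((gr M).filter (fun x => x ∉ M.closure (B : Set α)) : Finset α) : Set α)) := M.eRk_mono hsub
      _ ≤ M.eRk (M.closure (B : Set α)) +
            M.eRk ((((gr M).filter (fun x => x ∉ M.closure (B : Set α)) : Finset α) : Set α)) :=
          M.eRk_union_le_eRk_add_eRk _ _
      _ ≤ (q : ℕ∞) + (((gr M).filter (fun x => x ∉ M.closure (B : Set α))).card : ℕ∞) := by
          rw [M.eRk_closure_eq, hB]
          gcongr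
          rw [← Set.encard_coe_eq_coe_finsetCard]
          exact M.eRk_le_encard _
  have h2 := hrank.trans h1
  have h3 : q + 3 ≤ q + ((gr M).filter (fun x => x ∉ M.closure (B : Set α))).card := by exact_mod_cast h2
  omega

/-- The price of a rank-`q` set at the level `q + 1` is `ρ(E ∖ B)/(q + 1)` (or `0`), hence at most `(q + m_B)/(q + 1)`. -/
theorem price_succ_le_of_card_out {q : ℕ} {B : Finset α} (hB : B ∈ Profile.Rq M q) :
    Profile.price M q (q + 1) B ≤
      ((q : ℚ) + ((gr M).filter (fun x => x ∉ M.closure (B : Set α))).card) / ((q : ℚ) + 1) := by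
  have hBr := (Profile.mem_Rq.1 hB).2
  have hle := eRk_sdiff_le_add_card_out (M := M) B
  rw [hBr] at hle
  unfold Profile.price
  split_ifs with hu
  · set p' := (M.eRk ((gr M \ B : Finset α) : Set α)).toNat with hp'
    have hfin : M.eRk ((gr M \ B : Finset α) : Set α) ≠ ⊤ := by
      have := M.eRk_le_encard ((gr M \ B : Finset α) : Set α)
      rw [Set.encard_coe_eq_coe_finsetCard] at this
      exact ne_top_of_le_ne_top (ENat.coe_ne_top _) this
    have hp'le : p' ≤ q + ((gr M).filter (fun x => x ∉ M.closure (B : Set α))).card := by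
      rw [← ENat.coe_toNat hfin] at hle
      exact_mod_cast hle
    have hup' : q + 1 ≤ p' := by
      rw [← ENat.coe_toNat hfin] at hu
      exact_mod_cast hu
    rw [ThinGirth.choose_succ_div_choose (p' + q) q (by omega)]
    have hsub : p' + q - q = p' := by omega
    rw [hsub]
    have hden : ((q + 1 : ℕ) : ℚ) = (q : ℚ) + 1 := by push_cast; ring
    rw [hden]
    gcongr
    exact_mod_cast hp'le
  · apply div_nonneg <;> positivity

/-- For `y` outside the closure of a rank-`q` set `B`, `B ∪ {y}` is a rank-`(q+1)` set. -/
theorem insert_mem_levelSet_of_out {q : ℕ} {B : Finset α} (hB : B ∈ Profile.Rq M q) {y : α}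
    (hy : y ∈ (gr M).filter (fun x => x ∉ M.closure (B : Set α))) :
    insert y B ∈ Shadow.levelSet M (q + 1) := by
  rw [Finset.mem_filter] at hy
  rw [Profile.mem_levelSet]
  obtain ⟨hBg, hBr⟩ := Profile.mem_Rq.1 hB
  refine ⟨Finset.insert_subset hy.1 hBg, ?_⟩
  rw [← Staged.coe_rkN, rkN_insert_of_notMem_closure hy.1 hy.2]
  have : rkN M B = q := Staged.rkN_eq_iff.2 hBr
  rw [this]

omit [DecidableEq α] in
/-- A point outside the closure of `B` is not in `B`. -/
theorem notMem_of_mem_out {B : Finset α} (hBg : B ⊆ gr M) {y : α}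
    (hy : y ∈ (gr M).filter (fun x => x ∉ M.closure (B : Set α))) : y ∉ B := by
  rw [Finset.mem_filter] at hy
  intro hyB
  apply hy.2
  have hBE : (B : Set α) ⊆ M.E := by rw [← coe_gr]; exact_mod_cast hBg
  exact M.subset_closure (B : Set α) hBE (Finset.mem_coe.2 hyB)

/-- **The injection**: for rank-`q` sets `B ≠ B'` with at least `q + 1` points and `y ∉ cl B`, `y' ∉ cl B'`,
the sets `B ∪ {y}` and `B' ∪ {y'}` differ (girth `≥ q + 1`: otherwise `B ∩ B'` has `≥ q` points and rank `≤ q − 1`). -/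
theorem insert_ne_insert_of_ne {q : ℕ} (hg : ∀ T ⊆ M.E, T.encard ≤ q → M.Indep T)
    {B B' : Finset α} (hB : B ∈ Profile.Rq M q) (hB' : B' ∈ Profile.Rq M q)
    (_hBc : q + 1 ≤ B.card) (hB'c : q + 1 ≤ B'.card) (hne : B ≠ B') {y y' : α}
    (hy : y ∈ (gr M).filter (fun x => x ∉ M.closure (B : Set α)))
    (hy' : y' ∈ (gr M).filter (fun x => x ∉ M.closure (B' : Set α))) :
    insert y B ≠ insert y' B' := by
  intro heq
  obtain ⟨hBg, hBr⟩ := Profile.mem_Rq.1 hB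
  obtain ⟨hB'g, hB'r⟩ := Profile.mem_Rq.1 hB'
  have hyB : y ∉ B := notMem_of_mem_out hBg hy
  have hy'B' : y' ∉ B' := notMem_of_mem_out hB'g hy'
  have hrB : rkN M B = q := Staged.rkN_eq_iff.2 hBr
  have hrB' : rkN M B' = q := Staged.rkN_eq_iff.2 hB'r
  rw [Finset.mem_filter] at hy hy'
  have hrS : rkN M (insert y B) = q + 1 := by rw [rkN_insert_of_notMem_closure hy.1 hy.2, hrB]
  -- y ∈ B' (else y = y' and B = B')
  have hy_mem : y ∈ insert y' B' := heq ▸ Finset.mem_insert_self y B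
  rcases Finset.mem_insert.1 hy_mem with hyy | hyB'
  · subst hyy
    apply hne
    rw [← Finset.erase_insert hyB, ← Finset.erase_insert hy'B', heq]
  · have hU : B ∪ B' = insert y B := by
      apply subset_antisymm
      · apply Finset.union_subset (Finset.subset_insert y B)
        rw [heq]
        exact Finset.subset_insert y' B'
      · intro z hz
        rcases Finset.mem_insert.1 hz with rfl | hzB
        · exact Finset.mem_union_right _ hyB'
        · exact Finset.mem_union_left _ hzB
    have hUc : (B ∪ B').card = B.card + 1 := by rw [hU, Finset.card_insert_of_notMem hyB]
    have hIc : q ≤ (B ∩ B').card := by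
      have := Finset.card_union_add_card_inter B B'
      omega
    have hUr : rkN M (B ∪ B') = q + 1 := by rw [hU]; exact hrS
    have hsub := ThinTriangle.rkN_inter_add_union_le (M := M) B B'
    have hIr : rkN M (B ∩ B') + 1 ≤ q := by omega
    -- a q-subset of B ∩ B' is independent, of rank q ≤ rkN (B ∩ B')
    obtain ⟨T, hTI, hTc⟩ := Finset.exists_subset_card_eq hIc
    have hTg : (T : Set α) ⊆ M.E := by
      rw [← coe_gr]
      exact_mod_cast (hTI.trans Finset.inter_subset_left).trans hBg
    have hTi : M.Indep (T : Set α) := hg _ hTg (by rw [Set.encard_coe_eq_coe_finsetCard, hTc])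
    have hTr : rkN M T = q := by
      rw [Staged.rkN_eq_iff, hTi.eRk_eq_encard, Set.encard_coe_eq_coe_finsetCard, hTc]
    have := Staged.rkN_mono (M := M) hTI
    omega

/-- g6's bound for a sub-family: if `𝒜` consists of `q`-subsets of the ground set, `Σ_{B ∈ 𝒜} price ≤ C(n, u)` (`q ≤ u`). -/
theorem sum_price_le_choose_of_subset {q u : ℕ} (hqu : q ≤ u) {𝒜 : Finset (Finset α)}
    (h𝒜 : 𝒜 ⊆ Finset.powersetCard q (gr M)) :
    ∑ B ∈ 𝒜, Profile.price M q u B ≤ (Nat.choose (gr M).card u : ℚ) := by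
  set n := (gr M).card with hn
  have hcard : 𝒜.card ≤ Nat.choose n q := by
    rw [← Finset.card_powersetCard]
    exact Finset.card_le_card h𝒜
  calc ∑ B ∈ 𝒜, Profile.price M q u B
      ≤ ∑ _B ∈ 𝒜, (Nat.choose n u : ℚ) / (Nat.choose n q : ℚ) := by
        apply Finset.sum_le_sum
        intro B hB
        have hB' := h𝒜 hB
        rw [Finset.mem_powersetCard] at hB'
        exact price_le_of_card hqu hB'.1 hB'.2
    _ = (𝒜.card : ℚ) * ((Nat.choose n u : ℚ) / (Nat.choose n q : ℚ)) := by
        rw [Finset.sum_const, nsmul_eq_mul]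
    _ ≤ (Nat.choose n q : ℚ) * ((Nat.choose n u : ℚ) / (Nat.choose n q : ℚ)) := by
        apply mul_le_mul_of_nonneg_right _ (div_nonneg (Nat.cast_nonneg _) (Nat.cast_nonneg _))
        exact_mod_cast hcard
    _ ≤ (Nat.choose n u : ℚ) := by
        by_cases hz : (Nat.choose n q : ℚ) = 0
        · rw [hz, zero_mul]; exact Nat.cast_nonneg _
        · rw [mul_div_cancel₀ _ hz]

/-- **THE ROW `(q, q+1)` AT GIRTH `≥ q + 1` ON MATROIDS OF RANK `≥ q + 3`**: if every set of at most `q` points is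
independent, `q ≥ 1` and `ρ(E) ≥ q + 3`, then `Profile.ProfileIneq M q (q + 1)`. -/
theorem profileIneq_succ_of_girth_rank {q : ℕ} (hq : 1 ≤ q) (hg : ∀ T ⊆ M.E, T.encard ≤ q → M.Indep T)
    (hrank : ((q + 3 : ℕ) : ℕ∞) ≤ M.eRank) : Profile.ProfileIneq M q (q + 1) := by
  classical
  unfold Profile.ProfileIneq
  set n := (gr M).card with hn
  -- the two kinds of rank-q sets
  set Ra := (Profile.Rq M q).filter (fun B : Finset α => B.card = q) with hRa
  set Rb := (Profile.Rq M q).filter (fun B : Finset α => ¬ B.card = q) with hRb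
  have hsplit : ∑ B ∈ Profile.Rq M q, Profile.price M q (q + 1) B =
      ∑ B ∈ Ra, Profile.price M q (q + 1) B + ∑ B ∈ Rb, Profile.price M q (q + 1) B := by
    rw [hRa, hRb]
    exact (Finset.sum_filter_add_sum_filter_not _ _ _).symm
  have hRbmem : ∀ B ∈ Rb, B ∈ Profile.Rq M q ∧ q + 1 ≤ B.card := by
    intro B hB
    rw [hRb, Finset.mem_filter] at hB
    have h1 : rkN M B ≤ B.card := Staged.rkN_le_card B
    have h2 : rkN M B = q := Staged.rkN_eq_iff.2 (Profile.mem_Rq.1 hB.1).2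
    exact ⟨hB.1, by omega⟩
  -- (a) the q-subsets
  have hRa_sub : Ra ⊆ Finset.powersetCard q (gr M) := by
    intro B hB
    rw [hRa, Finset.mem_filter] at hB
    exact Finset.mem_powersetCard.2 ⟨(Profile.mem_Rq.1 hB.1).1, hB.2⟩
  have ha : ∑ B ∈ Ra, Profile.price M q (q + 1) B ≤ (Nat.choose n (q + 1) : ℚ) :=
    sum_price_le_choose_of_subset (by omega) hRa_sub
  -- (b) the fat rank-q sets: price ≤ (q + m_B)/(q+1) ≤ m_B − [card = q+1]
  have hb : ∑ B ∈ Rb, Profile.price M q (q + 1) B ≤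
      ∑ B ∈ Rb, ((((gr M).filter (fun x => x ∉ M.closure (B : Set α))).card : ℚ) -
        (if B.card = q + 1 then (1 : ℚ) else 0)) := by
    apply Finset.sum_le_sum
    intro B hB
    obtain ⟨hBq, _⟩ := hRbmem B hB
    have h1 := price_succ_le_of_card_out hBq
    have h3 := three_le_card_out hrank (Profile.mem_Rq.1 hBq).2
    set m := ((gr M).filter (fun x => x ∉ M.closure (B : Set α))).card with hm
    have h3' : (3 : ℚ) ≤ m := by exact_mod_cast h3
    have hq' : (1 : ℚ) ≤ q := by exact_mod_cast hq
    have hkey : ((q : ℚ) + m) / ((q : ℚ) + 1) ≤ (m : ℚ) - 1 := by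
      rw [div_le_iff₀ (by positivity)]
      nlinarith
    calc Profile.price M q (q + 1) B ≤ ((q : ℚ) + m) / ((q : ℚ) + 1) := h1
      _ ≤ (m : ℚ) - 1 := hkey
      _ ≤ (m : ℚ) - (if B.card = q + 1 then (1 : ℚ) else 0) := by
          split_ifs <;> linarith
  -- the level: independent (q+1)-subsets and the sets B ∪ {y}
  set I := (Finset.powersetCard (q + 1) (gr M)).filter (fun S : Finset α => M.Indep (S : Set α)) with hI
  set D := (Finset.powersetCard (q + 1) (gr M)).filter (fun S : Finset α => ¬ M.Indep (S : Set α)) with hD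
  have hID : I.card + D.card = Nat.choose n (q + 1) := by
    rw [hI, hD, Finset.card_filter_add_card_filter_not, Finset.card_powersetCard]
  set Rb1 := Rb.filter (fun B : Finset α => B.card = q + 1) with hRb1
  have hDRb1 : D = Rb1 := by
    ext S
    rw [hD, hRb1, hRb, Finset.mem_filter, Finset.mem_filter, Finset.mem_filter, Finset.mem_powersetCard,
      Profile.mem_Rq]
    constructor
    · rintro ⟨⟨hSg, hSc⟩, hdep⟩
      have hr := rkN_eq_of_dep_of_girth hg hSg hSc hdep
      refine ⟨⟨⟨hSg, Staged.rkN_eq_iff.1 hr⟩, by omega⟩, hSc⟩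
    · rintro ⟨⟨⟨hSg, hSr⟩, _⟩, hSc⟩
      refine ⟨⟨hSg, hSc⟩, ?_⟩
      intro hind
      have := hind.eRk_eq_encard
      rw [hSr, Set.encard_coe_eq_coe_finsetCard, hSc] at this
      have : q = q + 1 := by exact_mod_cast this
      omega
  have hI_sub : I ⊆ Shadow.levelSet M (q + 1) := by
    intro S hS
    rw [hI, Finset.mem_filter, Finset.mem_powersetCard] at hS
    rw [Profile.mem_levelSet]
    refine ⟨hS.1.1, ?_⟩
    rw [hS.2.eRk_eq_encard, Set.encard_coe_eq_coe_finsetCard, hS.1.2]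
  set J := Rb.biUnion (fun B => ((gr M).filter (fun x => x ∉ M.closure (B : Set α))).image
    (fun y => insert y B)) with hJ
  have hJ_sub : J ⊆ Shadow.levelSet M (q + 1) := by
    rw [hJ, Finset.biUnion_subset]
    intro B hB
    rw [Finset.image_subset_iff]
    intro y hy
    exact insert_mem_levelSet_of_out (hRbmem B hB).1 hy
  have hJcard : J.card = ∑ B ∈ Rb, ((gr M).filter (fun x => x ∉ M.closure (B : Set α))).card := by
    rw [hJ, Finset.card_biUnion]
    · apply Finset.sum_congr rfl
      intro B hB
      apply Finset.card_image_of_injOn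
      intro y hy y' hy' hyy'
      have hyB : y ∉ B := notMem_of_mem_out (Profile.mem_Rq.1 (hRbmem B hB).1).1 (Finset.mem_coe.1 hy)
      simp only at hyy'
      have hmem : y ∈ insert y' B := hyy' ▸ Finset.mem_insert_self y B
      rcases Finset.mem_insert.1 hmem with h | h
      · exact h
      · exact absurd h hyB
    · intro B hB B' hB' hne
      rw [Function.onFun, Finset.disjoint_left]
      intro S hS hS'
      rw [Finset.mem_image] at hS hS'
      obtain ⟨y, hy, rfl⟩ := hS
      obtain ⟨y', hy', heq⟩ := hS'
      obtain ⟨hBq, hBc⟩ := hRbmem B hB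
      obtain ⟨hB'q, hB'c⟩ := hRbmem B' hB'
      exact insert_ne_insert_of_ne hg hB'q hBq hB'c hBc (Ne.symm hne) hy' hy heq
  have hdisj : Disjoint I J := by
    rw [Finset.disjoint_left]
    intro S hSI hSJ
    rw [hI, Finset.mem_filter, Finset.mem_powersetCard] at hSI
    rw [hJ, Finset.mem_biUnion] at hSJ
    obtain ⟨B, hB, hSB⟩ := hSJ
    rw [Finset.mem_image] at hSB
    obtain ⟨y, hy, rfl⟩ := hSB
    obtain ⟨hBq, hBc⟩ := hRbmem B hB
    have hyB : y ∉ B := notMem_of_mem_out (Profile.mem_Rq.1 hBq).1 hy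
    have := Finset.card_insert_of_notMem hyB
    omega
  have hlevel : I.card + J.card ≤ (Shadow.levelSet M (q + 1)).card := by
    rw [← Finset.card_union_of_disjoint hdisj]
    exact Finset.card_le_card (Finset.union_subset hI_sub hJ_sub)
  -- the count of the (q+1)-circuits inside the b-sum
  have hc : ∑ B ∈ Rb, (if B.card = q + 1 then (1 : ℚ) else 0) = (D.card : ℚ) := by
    rw [Finset.sum_boole, hDRb1, hRb1]
  -- assemble
  have hbsum : ∑ B ∈ Rb, ((((gr M).filter (fun x => x ∉ M.closure (B : Set α))).card : ℚ) -
      (if B.card = q + 1 then (1 : ℚ) else 0)) = (J.card : ℚ) - (D.card : ℚ) := by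
    rw [Finset.sum_sub_distrib, hc, hJcard]
    push_cast
    rfl
  have hI' : (I.card : ℚ) = (Nat.choose n (q + 1) : ℚ) - (D.card : ℚ) := by
    have : (I.card : ℚ) + (D.card : ℚ) = (Nat.choose n (q + 1) : ℚ) := by exact_mod_cast hID
    linarith
  have hlevel' : (I.card : ℚ) + (J.card : ℚ) ≤ ((Shadow.levelSet M (q + 1)).card : ℚ) := by
    exact_mod_cast hlevel
  rw [hsplit]
  linarith

/-- **C-025 AT `(q + 2, q)` AT GIRTH `≥ q + 1` ON MATROIDS OF RANK `≥ q + 3`**. -/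
theorem rls_succ_succ_of_girth_rank {q : ℕ} (hq : 1 ≤ q) (hg : ∀ T ⊆ M.E, T.encard ≤ q → M.Indep T)
    (hrank : ((q + 3 : ℕ) : ℕ∞) ≤ M.eRank) : ThmN.RLS M (q + 2) q := by
  apply rls_of_profileIneq_rows
  intro u hqu hup
  have hu : u = q + 1 := by omega
  rw [hu]
  exact profileIneq_succ_of_girth_rank hq hg hrank

/-- **C-025 AT `(p, q)` FOR EVERY `p ≥ q + 2` AT GIRTH `≥ p − 1`**, on matroids of rank `≥ q + 3` (`q ≥ 1`): every set
with at most `p − 2` points independent. -/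
theorem rls_of_girth_rank (p q : ℕ) (hq : 1 ≤ q) (hpq : q + 2 ≤ p)
    (hg : ∀ T ⊆ M.E, T.encard + 2 ≤ p → M.Indep T) (hrank : ((q + 3 : ℕ) : ℕ∞) ≤ M.eRank) :
    ThmN.RLS M p q := by
  rcases Nat.lt_or_ge (q + 2) p with hlt | hge
  · exact rls_of_girth p q hlt hg
  · have hp : p = q + 2 := by omega
    subst hp
    apply rls_succ_succ_of_girth_rank hq _ hrank
    intro T hT hTc
    apply hg T hT
    have h2 : ((q : ℕ∞) + 2) = ((q + 2 : ℕ) : ℕ∞) := by norm_cast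
    rw [← h2]
    exact add_le_add_left hTc 2

end GirthRows

end PercRepro
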